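import Summits.QuantumFields.YangMills.Theorems.UnitScaleTiltProp7SectET3BgClass
import Literature.MathematicalPhysics.QuantumFieldTheory.Balaban1983to89.B9Prop26AtPinsOne
import Literature.MathematicalPhysics.QuantumFieldTheory.Balaban1983to89.B9PerturbationLettersAtOne
import Literature.MathematicalPhysics.QuantumFieldTheory.Balaban1983to89.B9Letters313AtOneDv
import Literature.MathematicalPhysics.QuantumFieldTheory.Balaban1983to89.B9LettersHZAtOne
import HarnessLib

/-!
# Route `UnitScaleTilt`, crux «MinimiserStabilityRegPr» (stmt-QuantumFields-19200, v10 stub EX, route (α), node N06(d = 3)) — (N06-3-4) FLAT-U CENSUS (OWNER 03:42:54Z):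
# **WHICH DISPLAYED ROWS OF THE T³ `norm_G` RESIDUE ARE INHABITED AT THE TRIVIAL BACKGROUND `U ≡ 1` OF THE T³ MEMBERS' OWN CARRIER `bgT3 i`** — Track A's `U = 1` theorems
# (seats dag-n06-h ∕ n06-w3 ∕ n06-l, d-generic over def-Y's k-level index) READ AT `d + 1 = 3`, `𝔸 := M₂(ℂ)`, `B := bgT3 i`, CLASS MAP THE IDENTITY, `U₁ := (bgT3 i).one` (`= cfgV1OfT3 1`)

Cell `ym3-torus` (HUMAN RULING D-0037, YM ladder rung R3 — NOT the Clay problem), width seat ym-ust-20520-w1 g3.  Count-neutral helper (`--supports stmt-QuantumFields-19200 --as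
helper`); registry untouched; THEOREMS ONLY (0 `def`, 0 `sorry`); nothing of [Balaban1985BackgroundPropagators] at curved `U` is asserted — a NON-VACUITY table for the XL residue of
`Prop7SectET3N06LeavesFromThm310.normG_row_of_thm310Obligations` (✓ p602933), «exactly what the tribunal ∕ judge will ask of an XL residue» (OWNER).

THE CENSUS (rows of the residue of record, OWNER 03:42:54Z; ✓ = inhabited at `U ≡ 1` by a theorem below ∕ by name; ○ = degenerate at `U ≡ 1`; ✗ = located obstruction; — = not in tree).
* (R1) G₀-layer OUTPUT `Thm33G0`-type majorants of the pinned model `G₀(1) = GcoK … O (bgT3 i).one` (and `∇G₀`, `G₀∇*`, `ΔG₀`): ✓ §2 `prop26_pins_one_T3` ([4] Prop. 2.6 (2.136) via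
  N03's `hasMajorant_Gop_kIdx`; constants member-uniform on the band).  The Theorem-3.10 INPUT schemas `Local342G`∕`Factors389`∕`Identities310` per cube at `U ≡ 1` (= Cor. 3.5 ∕
  [4] per cube): — (no `U = 1` inhabitant typed in the tree; print: Cor. 3.5 p.407 «we have proved these theorems for … U = 1»).
* (3.131)∕(3.137) letters `Letters3131` and the perturbation steps: ○ §3 `letters3131_one_T3` — `Δ′_π(1) = Δ⁽²⁾_π(1) = 0` (`tpicoK∕t2coK_eq_zero_of_cfg_one`), zero letters, any `t ≥ 0`.
* (3.132)∕(3.126)∕(3.152) letters `LettersRowT3` = `Letters313`: `q2 q1 gQs1` ✓ §4 `letters313_Q_one_T3`; `gD1 gD2` ✓ §4 `letters313_Dv_one_T3`; `gQs2` ✓ by name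
  `B9LettersHAtOneG0.lettersH_G0_one_kIdx (d := 2)`; `rgd1 rgd2` (the `R∘D_v*∘G₁` letters — the socket of the SITE-sector `G′(U)`∕(3.49), ✓ p602256's `eBlock_Gp_T3_of_cubes` feeds it): — ;
  **`c1_2 c1_1` (the `C₁ = (QG₁Q*)⁻¹` letters): ✗ at the FLAT coarse class** — dag-n06-h's `B9LettersHCOneObstruction` (the kernel of `(QGQ*)⁻¹` carries `L^{+j(d+1)}`, no member-uniform `B₃`
  between the flat classes `Z² → Z⁰`; a typing∕units defect of the schema × pin, not an estimate) — REPAIR OF RECORD = the weighted class `Z_{wZ}`, `wZ = n⁻¹` (★w1 g2's `LettersRowZT3`,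
  Track A's `Letters313Z` ∕ `thm313Printed_completePairMBZ`), whose `G₀`-side letters ARE inhabited at `U ≡ 1`: ✓ §5 `lettersHZ_G0_one_T3`.
* `Letters313D` (`dgQs rgdH dgDH`): `dgQs` ✓ by name `lettersH_G0_one_kIdx`; `rgdH dgDH` — .  `FormSmall` ∕ `Identities` ∕ co-readings `CoRealizes`∕`CoReadsGlob`: ○∕definitional at genuine pins
  (Track A `B9Thm311InputsAtOne`, `B9CoRealizesRelAtLetters`).  Residual (3.46)∕(3.43)–(3.45): Track A `B9ResidualEntriesAtOne(AtLetters)` (by name, d-generic).  (BG-336) `ClassTransferT3`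
  at `U ≡ 1`: ✓ ★w1 g2 `reg335_reg336_cfgV1OfT3_one` + `regPr_one_member`.
HONEST SCOPE: by-name ports at the identity class map (`(bgT3 i).Cfg = CfgY M₂(ℂ) i`, `(bgT3 i).one = fun _ _ ↦ 1` by `rfl`); partial witnesses at `U = 1` only — the displayed `∀U`-binders
of the leaf are NOT witnessed; N06(d = 3) is NOT discharged; nothing here claims EX, the crux, V3∕R3, d = 4 or the mass gap; rung R3, not Clay.

References: T. Bałaban, CMP **99** (1985) 389–434 [Balaban1985BackgroundPropagators] (Cor. 3.5 p.407, Thm 3.3 p.399, (3.42) p.397, (3.126) p.420, (3.130)–(3.138) pp.421–423, (3.132)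
p.422, (3.147)–(3.153) pp.425–426, Thm 3.13 p.426); CMP **96** (1984) 223–250 [Balaban1984PropagatorsII] (Prop. 2.6 (2.136) p.247, Lemma 2.1 (2.60)–(2.61) p.234, (2.142) p.248).
-/

set_option autoImplicit false

noncomputable section

open scoped Matrix.Norms.L2Operator Matrix

namespace Summit.QuantumFields.YangMills.Theorems.Prop7SectET3LettersAtOne

open Literature.MathematicalPhysics.QuantumFieldTheory.Balaban1983to89
open Literature.MathematicalPhysics.QuantumFieldTheory.Balaban1983to89.Node00
open Literature.MathematicalPhysics.QuantumFieldTheory.Balaban1983to89.Node00.OpsYSectDCoords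
open Literature.MathematicalPhysics.QuantumFieldTheory.Balaban1983to89.B9CoReadingCoords
open Literature.MathematicalPhysics.QuantumFieldTheory.Balaban1983to89.B9CoReadingCoordsH
open Literature.MathematicalPhysics.QuantumFieldTheory.Balaban1983to89.B9CoReadingCoordsS
open Literature.MathematicalPhysics.QuantumFieldTheory.Balaban1983to89.B6KLevelCensusIndexV1 (KIdx kGeo kGeoG)
open Literature.MathematicalPhysics.QuantumFieldTheory.Balaban1983to89.B6GlobalChartV1 (PV blkV1)
open Literature.MathematicalPhysics.QuantumFieldTheory.Balaban1983to89.B6Geom246MultiLevelTorus (geomT)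
open Literature.MathematicalPhysics.QuantumFieldTheory.Balaban1983to89.B6Ineq2142KLevelV1 (lvl β)
open Literature.MathematicalPhysics.QuantumFieldTheory.Balaban1983to89.B6Prop26Census2136KLevelV1 (Gop)
open Literature.MathematicalPhysics.QuantumFieldTheory.Balaban1983to89.B6RandomWalk (HasMajorant)
open Literature.MathematicalPhysics.QuantumFieldTheory.Balaban1983to89.B9GeoNormsKLevelV1 (geo9K)
open Literature.MathematicalPhysics.QuantumFieldTheory.Balaban1983to89.B9Thm39ReadingCoords (cR39)
open Literature.MathematicalPhysics.QuantumFieldTheory.Balaban1983to89.B9Thm34Ext (toB6)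
open Literature.MathematicalPhysics.QuantumFieldTheory.Balaban1983to89.B9SectDSup (weightNorm)
open Literature.MathematicalPhysics.QuantumFieldTheory.Balaban1983to89.B11SectG (HasMaj BlockNorm)
open Literature.MathematicalPhysics.QuantumFieldTheory.Balaban1983to89.B9Thm312Whole (cNorm GeoOK Ops)
open Literature.MathematicalPhysics.QuantumFieldTheory.Balaban1983to89.B9Thm312WholeStepFrom3131 (Letters3131)
open Literature.MathematicalPhysics.QuantumFieldTheory.Balaban1983to89.B9Prop26AtPinsOne (hasMajorant_pins_one_kIdx)
open Literature.MathematicalPhysics.QuantumFieldTheory.Balaban1983to89.B9PerturbationLettersAtOne (letters3131_of_pins_one)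
open Literature.MathematicalPhysics.QuantumFieldTheory.Balaban1983to89.B9Letters313AtOneQ (letters313_Q_one_kIdx)
open Literature.MathematicalPhysics.QuantumFieldTheory.Balaban1983to89.B9Letters313AtOneDv (letters313_Dv_one_kIdx)
open Literature.MathematicalPhysics.QuantumFieldTheory.Balaban1983to89.B9LettersHZAtOne (lettersHZ_G0_one_kIdx)
open Summit.QuantumFields.YangMills.Theorems.Prop7SectET3Members (hd3)
open Summit.QuantumFields.YangMills.Theorems.Prop7SectET3BgClass (bgT3 cfgV1OfT3)

variable {ℓ : ℕ} {hL : Odd (ℓ + 1) ∧ 1 < ℓ + 1} {b₀ b₁ : ℝ}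
variable {κ : Type} [Fintype κ]

/-! ## §1 The trivial background of the T³ member's carrier reads `1` through the identity class map -/

/-- `(bgT3 i).one` is the constant field `1` (def-Y's `bg9K`), so the identity class map reads it as `fun _ _ ↦ 1` — the hypothesis `cfg U₁ = 1` of every Track-A `U = 1` theorem, by `rfl`
at the T³ carrier; and it is the V1 reading of the route's trivial SU(2) field (★w1 g2 `cfgV1OfT3_one`). [cite: Balaban1985RegularSpaces, p.98 («identically equal to 1»)] -/
theorem bgT3_one_eq (i : KIdx 2 ℓ hd3 hL b₀ b₁) : (fun U : (bgT3 i).Cfg => U) (bgT3 i).one = fun _ _ => 1 := rfl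

/-! ## §2 (R1)-output: the pinned `G₀` model and its three companions have Thm-3.3-type block majorants at `U ≡ 1` -/

/-- ✓ **[4] PROP. 2.6 (2.136) READ ONTO THE PINNED MODELS AT THE T³ MEMBERS' TRIVIAL BACKGROUND**, uniformly on the band `0 < b₀ ≤ b₁` (dag-n06-h's `hasMajorant_pins_one_kIdx` at
`d := 2`, `B := bgT3 i`, class map the identity, `U₁ := (bgT3 i).one`): `M₁, δ₃, C > 0` such that for every T³-index member with `M ≥ M₁`, every real basis `b` of `M₂(ℂ)`, every bond
letter `O` with the `U = 1` clause `O(1)(J ⊗ E) = (GJ) ⊗ E`, the pinned models `GcoK` (= `G₀(1)`), `DcoK∘GcoK`, `GcoK∘DscoK`, `LcoK∘GcoK` have the block majorants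
`cR39 b·C·[η²L^{2j}, ηL^{j}, ηL^{j}, 1]·e^{−δ₃ d_T}` — the `U ≡ 1` inhabitant of the SHAPE of the leaf's `Thm33G0.e0` ∕ `LeftStep.e1` ∕ `Thm33G0.e2` (and the Laplacian companion).
[cite: Balaban1984PropagatorsII, Prop. 2.6 (2.136) p.247, (2.51) p.232; Balaban1985BackgroundPropagators, Thm 3.3 p.399, (3.42) p.397, Cor. 3.5 p.407] -/
theorem prop26_pins_one_T3 (hb₀ : 0 < b₀) (hb₁ : b₀ ≤ b₁) : ∃ M₁ δ₃ C : ℝ, 0 < M₁ ∧ 0 < δ₃ ∧ 0 < C ∧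
    ∀ i : KIdx 2 ℓ hd3 hL b₀ b₁, M₁ ≤ (kGeoG i).M → ∀ (b : Module.Basis κ ℝ (Matrix (Fin 2) (Fin 2) ℂ)) (O : BondOpY (Matrix (Fin 2) (Fin 2) ℂ) i),
      (∀ (J : FBondY i → ℝ) (E : Matrix (Fin 2) (Fin 2) ℂ), O (fun _ _ => 1) (liftY J E) = liftY (Gop i J) E) →
        HasMajorant (g := geomT i.D) (fun p : XBK κ i => blkV1 i.hN i.D p.1) (GcoK i b (bgT3 i) (fun U => U) O (bgT3 i).one)
            (fun y y' => cR39 b * (C * |i.cf|⁻¹ ^ 2 * ((ℓ : ℝ) + 1) ^ (2 * y.1.1) * Real.exp (-(δ₃ * (geomT i.D).dist y y')))) ∧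
        HasMajorant (g := geomT i.D) (fun p : XBK κ i => blkV1 i.hN i.D p.1) (DcoK i b (bgT3 i) (fun U => U) (bgT3 i).one ∘ₗ GcoK i b (bgT3 i) (fun U => U) O (bgT3 i).one)
            (fun y y' => cR39 b * (C * |i.cf|⁻¹ ^ 1 * ((ℓ : ℝ) + 1) ^ (1 * y.1.1) * Real.exp (-(δ₃ * (geomT i.D).dist y y')))) ∧
        HasMajorant (g := geomT i.D) (fun p : XBK κ i => blkV1 i.hN i.D p.1) (GcoK i b (bgT3 i) (fun U => U) O (bgT3 i).one ∘ₗ DscoK i b (bgT3 i) (fun U => U) (bgT3 i).one)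
            (fun y y' => cR39 b * (C * |i.cf|⁻¹ ^ 1 * ((ℓ : ℝ) + 1) ^ (1 * y.1.1) * Real.exp (-(δ₃ * (geomT i.D).dist y y')))) ∧
        HasMajorant (g := geomT i.D) (fun p : XBK κ i => blkV1 i.hN i.D p.1) (LcoK i b (bgT3 i) (fun U => U) (bgT3 i).one ∘ₗ GcoK i b (bgT3 i) (fun U => U) O (bgT3 i).one)
            (fun y y' => cR39 b * (C * |i.cf|⁻¹ ^ 0 * ((ℓ : ℝ) + 1) ^ (0 * y.1.1) * Real.exp (-(δ₃ * (geomT i.D).dist y y')))) := by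
  obtain ⟨M₁, δ₃, C, hM₁, hδ₃, hC, H⟩ :=
    hasMajorant_pins_one_kIdx (d := 2) (ℓ := ℓ) (hd := hd3) (hL := hL) (b₀ := b₀) (b₁ := b₁) (𝔸 := Matrix (Fin 2) (Fin 2) ℂ) (κ := κ) hb₀ hb₁
  exact ⟨M₁, δ₃, C, hM₁, hδ₃, hC, fun i hM b O hO => H i hM b (bgT3 i) (fun U => U) O hO (bgT3 i).one rfl⟩

/-! ## §3 (3.131)∕(3.137): the perturbation letters vanish at `U ≡ 1`, so `Letters3131` holds there with the zero split (degenerate) -/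

section Perturbation

variable {g : B9.Geometry} [Fintype g.Site] {Y Z W : Type} [Fintype W] {R₀ : ℝ} {H₀ : Prop}

/-- ○ **`Letters3131` AT THE T³ MEMBERS' TRIVIAL BACKGROUND** (dag-n06-w3's `letters3131_of_pins_one` at `B := bgT3 i`, class map the identity, `U₁ := (bgT3 i).one`): for a letter record
`𝔬` whose `Tpi`∕`T2` are pinned to node00-def-Y's coordinate models `TpicoK`∕`T2coK` (any site transporter `parS`, site letter `Gp`, second-order bond letter `Δ2` with `Δ2(1) = 0`),
`Δ′_π(1) = Δ⁽²⁾_π(1) = 0`, hence the (3.131)∕(3.137) split holds with the ZERO letters `T_a = T_a₂ = T_b = T_b₂ = 0` for every `t ≥ 0`, `δ_T` — the degenerate `U ≡ 1` inhabitant of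
the residue's `hL3131` row. [cite: Balaban1985BackgroundPropagators, (3.120)–(3.121) pp.419–420, (3.130)–(3.131) pp.421–422, (3.135)–(3.137) pp.422–423, Cor. 3.5 p.407] -/
theorem letters3131_one_T3 (i : KIdx 2 ℓ hd3 hL b₀ b₁) (b : Module.Basis κ ℝ (Matrix (Fin 2) (Fin 2) ℂ))
    (parS : SiteParY (Matrix (Fin 2) (Fin 2) ℂ) i) (Gp : SiteOpY (Matrix (Fin 2) (Fin 2) ℂ) i) (Δ2 : BondOpY (Matrix (Fin 2) (Fin 2) ℂ) i)
    (𝔬 : Ops g (bgT3 i) (XBK κ i) Y Z W) (hΔ : Δ2 (fun _ _ => 1) = 0)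
    (hTpi : 𝔬.Tpi (bgT3 i).one = TpicoK i b (bgT3 i) (fun U => U) parS Gp (bgT3 i).one)
    (hT2 : 𝔬.T2 (bgT3 i).one = T2coK i b (bgT3 i) (fun U => U) parS Gp Δ2 (bgT3 i).one)
    {hlen : ∀ y : g.Site, 0 ≤ g.len y} {t δT : ℝ} (ht : 0 ≤ t) :
    Letters3131 𝔬 (fun _ => 0) (fun _ => 0) (fun _ => 0) (fun _ => 0) R₀ H₀ hlen t δT (bgT3 i).one :=
  letters3131_of_pins_one i b (bgT3 i) (fun U => U) parS Gp Δ2 𝔬 (bgT3 i).one rfl hΔ hTpi hT2 rfl rfl rfl rfl ht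

end Perturbation

/-! ## §4 (3.132)∕(3.126) letters of `LettersRowT3` at `U ≡ 1`: `q2`, `q1`, `gQs1` and `gD1`, `gD2` -/

/-- ✓ **THE LETTERS `q2`, `q1`, `gQs1` OF `Letters313` AT THE T³ MEMBERS' TRIVIAL BACKGROUND, UNIFORMLY ON THE BAND** (n06-w3's `letters313_Q_one_kIdx` at `d := 2`, `B := bgT3 i`, class map
the identity, `U₁ := (bgT3 i).one`): `M₁, B₃, δ₃ > 0` such that for every T³-index member with `M ≥ M₁`, every real basis `b` of `M₂(ℂ)` with `cR39 b ≠ 0`, every letter record `𝔬` over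
`geo9K i` ∕ `bgT3 i` with carriers `XBK ∕ Y ∕ XHK ∕ W`, `G0`∕`Qstar`∕`Q` pinned at `(bgT3 i).one` to `GcoK`∕`QscoKH`∕`QcoKH` (transporters trivial at `1`, `O(1)(J ⊗ E) = (GJ) ⊗ E`), block
maps `blkBK bI` ∕ `blkHK` (`bI` level- and 1-faithful): `Q(1) : 𝔠⁽²⁾ → 𝔠_Z⁽²⁾`, `𝔠⁽¹⁾ → 𝔠_Z⁽¹⁾` (majorant `B₃(cR39 b)⁻¹e^{−δ₃d}`) and `G₀(1)Q*(1) : 𝔠_Z^{len} → 𝔠⁽¹⁾` (`B₃e^{−δ₃d}`).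
[cite: Balaban1985BackgroundPropagators, Thm 3.13 p.426, (3.126) p.420, (3.42) p.397, Cor. 3.5 p.407; Balaban1984PropagatorsII, (2.18)–(2.20) p.226, Prop. 2.6 (2.136) p.247, Lemma 2.1 (2.60)–(2.61) p.234] -/
theorem letters313_Q_one_T3 (hb₀ : 0 < b₀) (hb₁ : b₀ ≤ b₁) : ∃ M₁ B₃ δ₃ : ℝ, 0 < M₁ ∧ 0 < B₃ ∧ 0 < δ₃ ∧
    ∀ i : KIdx 2 ℓ hd3 hL b₀ b₁, M₁ ≤ (geo9K i).M → ∀ (hG : GeoOK (geo9K i)) [Fintype (geo9K i).Site] {Y W : Type} [Fintype Y] [Fintype W]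
      (b : Module.Basis κ ℝ (Matrix (Fin 2) (Fin 2) ℂ)), cR39 b ≠ 0 → ∀ (O : BondOpY (Matrix (Fin 2) (Fin 2) ℂ) i) (parB : BondParY (Matrix (Fin 2) (Fin 2) ℂ) i),
      (∀ s s', parB (fun _ _ => 1) s s' = 1) → (∀ (J : FBondY i → ℝ) (E : Matrix (Fin 2) (Fin 2) ℂ), O (fun _ _ => 1) (liftY J E) = liftY (Gop i J) E) →
      ∀ {bI : FBondY i → IBondY i},
      (∀ f : FBondY i, lvl i.hN i.D i.hk (bI f) = (blkV1 i.hN i.D f).1.1) →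
      (∀ f : FBondY i, (geomT i.D).dist (β i.hN i.D i.hk (bI f)) (blkV1 i.hN i.D f) ≤ 1) →
      ∀ (𝔬 : Ops (geo9K i) (bgT3 i) (XBK κ i) Y (XHK κ i) W),
      𝔬.blk = blkBK i bI → 𝔬.blkZ = blkHK i →
      𝔬.G0 (bgT3 i).one = GcoK i b (bgT3 i) (fun U => U) O (bgT3 i).one →
      𝔬.Qstar (bgT3 i).one = QscoKH i b (bgT3 i) (fun U => U) parB (bgT3 i).one →
      𝔬.Q (bgT3 i).one = QcoKH i b (bgT3 i) (fun U => U) parB (bgT3 i).one →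
      ∀ {R₀ : ℝ} {H₀ : Prop},
        HasMaj (cNorm R₀ H₀ 𝔬.blk hG.lenle 2) (cNorm R₀ H₀ 𝔬.blkZ hG.lenle 2) (𝔬.Q (bgT3 i).one)
          (fun a a' => B₃ * (cR39 b)⁻¹ * Real.exp (-(δ₃ * (geo9K i).dist a a'))) ∧
        HasMaj (cNorm R₀ H₀ 𝔬.blk hG.lenle 1) (cNorm R₀ H₀ 𝔬.blkZ hG.lenle 1) (𝔬.Q (bgT3 i).one)
          (fun a a' => B₃ * (cR39 b)⁻¹ * Real.exp (-(δ₃ * (geo9K i).dist a a'))) ∧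
        HasMaj (weightNorm (BlockNorm.ofBlocks (toB6 (geo9K i) R₀ H₀) 𝔬.blkZ) (geo9K i).len fun y => (hG.lenpos y).le)
          (cNorm R₀ H₀ 𝔬.blk hG.lenle 1) (𝔬.G0 (bgT3 i).one ∘ₗ 𝔬.Qstar (bgT3 i).one) (fun a a' => B₃ * Real.exp (-(δ₃ * (geo9K i).dist a a'))) := by
  obtain ⟨M₁, B₃, δ₃, hM₁, hB₃, hδ₃, H⟩ :=
    letters313_Q_one_kIdx (d := 2) (ℓ := ℓ) (hd := hd3) (hL := hL) (b₀ := b₀) (b₁ := b₁) (𝔸 := Matrix (Fin 2) (Fin 2) ℂ) (κ := κ) hb₀ hb₁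
  refine ⟨M₁, B₃, δ₃, hM₁, hB₃, hδ₃, fun i hM hG _ Y W _ _ b hc O parB hparB hO bI hlev hβ1 𝔬 hblk hblkZ hG0 hQs hQ R₀ H₀ => ?_⟩
  exact H i hM hG b hc (bgT3 i) (fun U => U) O parB hparB hO (U₁ := (bgT3 i).one) rfl hlev hβ1 𝔬 hblk hblkZ hG0 hQs hQ

/-- ✓ **THE LETTERS `gD1`, `gD2` OF `Letters313` AT THE T³ MEMBERS' TRIVIAL BACKGROUND, UNIFORMLY ON THE BAND** (n06-w3's `letters313_Dv_one_kIdx` at `d := 2`, `B := bgT3 i`, class map the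
identity, `U₁ := (bgT3 i).one`): `M₁, B₃, δ₃ > 0` such that for every T³-index member with `M ≥ M₁`, every real basis `b` of `M₂(ℂ)`, every letter record `𝔬` with carriers `XBK ∕ Y ∕ Z ∕ XSK`,
`G0`∕`Dv` pinned at `(bgT3 i).one` to `GcoK`∕`DvcoKH`, block maps `blkBK bI` ∕ `blkSK (sIK bI)`: `G₀(1)D_v(1) : 𝔠_W⁽⁰⁾ → 𝔠⁽¹⁾` and `𝔠_W⁽¹⁾ → 𝔠⁽²⁾` with the majorant `B₃·cR39 b·e^{−δ₃d}`
([4] (2.136)₃ read onto `G₀∂` through `∂λ = −Σ_μ ∇*_μ J_μ(λ)`). [cite: Balaban1985BackgroundPropagators, Thm 3.13 p.426, (3.153) p.426, (3.17) p.394, Thm 3.3 p.399, Cor. 3.5 p.407; Balaban1984PropagatorsII, Prop. 2.6 (2.136) p.247, Lemma 2.1 (2.60)–(2.61) p.234] -/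
theorem letters313_Dv_one_T3 (hb₀ : 0 < b₀) (hb₁ : b₀ ≤ b₁) : ∃ M₁ B₃ δ₃ : ℝ, 0 < M₁ ∧ 0 < B₃ ∧ 0 < δ₃ ∧
    ∀ i : KIdx 2 ℓ hd3 hL b₀ b₁, M₁ ≤ (geo9K i).M → ∀ (hG : GeoOK (geo9K i)) [Fintype (geo9K i).Site] {Y Z : Type} [Fintype Y] [Fintype Z]
      (b : Module.Basis κ ℝ (Matrix (Fin 2) (Fin 2) ℂ)) (O : BondOpY (Matrix (Fin 2) (Fin 2) ℂ) i),
      (∀ (J : FBondY i → ℝ) (E : Matrix (Fin 2) (Fin 2) ℂ), O (fun _ _ => 1) (liftY J E) = liftY (Gop i J) E) →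
      ∀ {bI : FBondY i → IBondY i},
      (∀ f : FBondY i, lvl i.hN i.D i.hk (bI f) = (blkV1 i.hN i.D f).1.1) →
      (∀ f : FBondY i, (geomT i.D).dist (β i.hN i.D i.hk (bI f)) (blkV1 i.hN i.D f) ≤ 1) →
      ∀ (𝔬 : Ops (geo9K i) (bgT3 i) (XBK κ i) Y Z (XSK κ i)),
      𝔬.blk = blkBK i bI → 𝔬.blkW = blkSK i (sIK i bI) →
      𝔬.G0 (bgT3 i).one = GcoK i b (bgT3 i) (fun U => U) O (bgT3 i).one → 𝔬.Dv (bgT3 i).one = DvcoKH i b (bgT3 i) (fun U => U) (bgT3 i).one →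
      ∀ {R₀ : ℝ} {H₀ : Prop},
        HasMaj (cNorm R₀ H₀ 𝔬.blkW hG.lenle 0) (cNorm R₀ H₀ 𝔬.blk hG.lenle 1) (𝔬.G0 (bgT3 i).one ∘ₗ 𝔬.Dv (bgT3 i).one)
          (fun a a' => B₃ * cR39 b * Real.exp (-(δ₃ * (geo9K i).dist a a'))) ∧
        HasMaj (cNorm R₀ H₀ 𝔬.blkW hG.lenle 1) (cNorm R₀ H₀ 𝔬.blk hG.lenle 2) (𝔬.G0 (bgT3 i).one ∘ₗ 𝔬.Dv (bgT3 i).one)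
          (fun a a' => B₃ * cR39 b * Real.exp (-(δ₃ * (geo9K i).dist a a'))) := by
  obtain ⟨M₁, B₃, δ₃, hM₁, hB₃, hδ₃, H⟩ :=
    letters313_Dv_one_kIdx (d := 2) (ℓ := ℓ) (hd := hd3) (hL := hL) (b₀ := b₀) (b₁ := b₁) (𝔸 := Matrix (Fin 2) (Fin 2) ℂ) (κ := κ) hb₀ hb₁
  refine ⟨M₁, B₃, δ₃, hM₁, hB₃, hδ₃, fun i hM hG _ Y Z _ _ b O hO bI hlev hβ1 𝔬 hblk hblkW hG0 hDv R₀ H₀ => ?_⟩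
  exact H i hM hG b (bgT3 i) (fun U => U) O hO (U₁ := (bgT3 i).one) rfl hlev hβ1 𝔬 hblk hblkW hG0 hDv

/-! ## §5 The repaired coarse class: the `G₀`-side letters of the Z-species (`LettersRowZT3`) at `U ≡ 1` -/

/-- ✓ **THE `G₀`-SIDE LETTERS OF THE R1-cls (Z) SCHEMAS AT THE T³ MEMBERS' TRIVIAL BACKGROUND** (n06-l's `lettersHZ_G0_one_kIdx` at `d := 2`, `B := bgT3 i`, class map the identity,
`U₁ := (bgT3 i).one`) — the repair of record of the located flat-class obstruction of the `C`-adjacent letters: out of a block-count-weighted coarse class `Z_{Wt}` with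
`Wt(a′) ≥ (L³)^{−j(a′)}`, `G₀(1)Q*(1) : Z_{Wt} → 𝔠⁽²⁾`, `∇G₀(1)Q*(1) : Z_{Wt} → 𝔠_Y⁽¹⁾`, `G₀(1)Q*(1) : Z_{len·Wt} → 𝔠⁽¹⁾`, all with `B₃·e^{−δ₃d}`, `M₁ B₃ δ₃` member-uniform on the band.
[cite: Balaban1985BackgroundPropagators, (3.126) p.420, (3.132)–(3.133) p.422, Thm 3.3 p.399, Thm 3.13 p.426, Cor. 3.5 p.407; Balaban1984PropagatorsII, Prop. 2.6 (2.136) p.247, Lemma 2.1 (2.60)–(2.61) p.234] -/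
theorem lettersHZ_G0_one_T3 (hb₀ : 0 < b₀) (hb₁ : b₀ ≤ b₁) : ∃ M₁ B₃ δ₃ : ℝ, 0 < M₁ ∧ 0 < B₃ ∧ 0 < δ₃ ∧
    ∀ i : KIdx 2 ℓ hd3 hL b₀ b₁, M₁ ≤ (geo9K i).M → ∀ (hG : GeoOK (geo9K i)) [Fintype (geo9K i).Site] {W : Type} [Fintype W]
      (b : Module.Basis κ ℝ (Matrix (Fin 2) (Fin 2) ℂ)), cR39 b ≠ 0 → ∀ (O : BondOpY (Matrix (Fin 2) (Fin 2) ℂ) i) (parB : BondParY (Matrix (Fin 2) (Fin 2) ℂ) i),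
      (∀ s s', parB (fun _ _ => 1) s s' = 1) → (∀ (J : FBondY i → ℝ) (E : Matrix (Fin 2) (Fin 2) ℂ), O (fun _ _ => 1) (liftY J E) = liftY (Gop i J) E) →
      ∀ {bI : FBondY i → IBondY i},
      (∀ f : FBondY i, lvl i.hN i.D i.hk (bI f) = (blkV1 i.hN i.D f).1.1) →
      (∀ f : FBondY i, (geomT i.D).dist (β i.hN i.D i.hk (bI f)) (blkV1 i.hN i.D f) ≤ 1) →
      ∀ (𝔬 : Ops (geo9K i) (bgT3 i) (XBK κ i) (XBK κ i) (XHK κ i) W),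
      𝔬.blk = blkBK i bI → 𝔬.blkY = blkBK i bI → 𝔬.blkZ = blkHK i →
      𝔬.G0 (bgT3 i).one = GcoK i b (bgT3 i) (fun U => U) O (bgT3 i).one →
      𝔬.Qstar (bgT3 i).one = QscoKH i b (bgT3 i) (fun U => U) parB (bgT3 i).one →
      𝔬.D (bgT3 i).one = DcoK i b (bgT3 i) (fun U => U) (bgT3 i).one →
      ∀ {Wt : (geo9K i).Site → ℝ} (hW0 : ∀ a, 0 ≤ Wt a) (hW1 : ∀ a, 0 ≤ (geo9K i).len a * Wt a),
      (∀ a : IBondY i, ((((ℓ + 1 : ℕ) : ℝ) ^ (2 + 1)) ^ lvl i.hN i.D i.hk a)⁻¹ ≤ Wt a) →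
      ∀ {R₀ : ℝ} {H₀ : Prop},
        HasMaj (weightNorm (BlockNorm.ofBlocks (toB6 (geo9K i) R₀ H₀) 𝔬.blkZ) Wt hW0) (cNorm R₀ H₀ 𝔬.blk hG.lenle 2)
          (𝔬.G0 (bgT3 i).one ∘ₗ 𝔬.Qstar (bgT3 i).one) (fun a a' => B₃ * Real.exp (-(δ₃ * (geo9K i).dist a a'))) ∧
        HasMaj (weightNorm (BlockNorm.ofBlocks (toB6 (geo9K i) R₀ H₀) 𝔬.blkZ) Wt hW0) (cNorm R₀ H₀ 𝔬.blkY hG.lenle 1)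
          (𝔬.D (bgT3 i).one ∘ₗ 𝔬.G0 (bgT3 i).one ∘ₗ 𝔬.Qstar (bgT3 i).one) (fun a a' => B₃ * Real.exp (-(δ₃ * (geo9K i).dist a a'))) ∧
        HasMaj (weightNorm (BlockNorm.ofBlocks (toB6 (geo9K i) R₀ H₀) 𝔬.blkZ) (fun y => (geo9K i).len y * Wt y) hW1)
          (cNorm R₀ H₀ 𝔬.blk hG.lenle 1) (𝔬.G0 (bgT3 i).one ∘ₗ 𝔬.Qstar (bgT3 i).one) (fun a a' => B₃ * Real.exp (-(δ₃ * (geo9K i).dist a a'))) := by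
  obtain ⟨M₁, B₃, δ₃, hM₁, hB₃, hδ₃, H⟩ :=
    lettersHZ_G0_one_kIdx (d := 2) (ℓ := ℓ) (hd := hd3) (hL := hL) (b₀ := b₀) (b₁ := b₁) (𝔸 := Matrix (Fin 2) (Fin 2) ℂ) (κ := κ) hb₀ hb₁
  refine ⟨M₁, B₃, δ₃, hM₁, hB₃, hδ₃, fun i hM hG _ W _ b hc O parB hparB hO bI hlev hβ1 𝔬 hblk hblkY hblkZ hG0 hQs hD Wt hW0 hW1 hWt R₀ H₀ => ?_⟩
  exact H i hM hG b hc (bgT3 i) (fun U => U) O parB hparB hO (U₁ := (bgT3 i).one) rfl hlev hβ1 𝔬 hblk hblkY hblkZ hG0 hQs hD hW0 hW1 hWt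

end Summit.QuantumFields.YangMills.Theorems.Prop7SectET3LettersAtOne

end
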